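import Literature.AnabelianGeometry.SemiGraphs.TemperedReconstructionVertexMapProofsAt
import Literature.AnabelianGeometry.SemiGraphs.TemperedReconstructionEdgeMapProofsAt
import Literature.AnabelianGeometry.SemiGraphs.TemperedMaximalCompactAnchoredOfLocallyFinite
import HarnessLib

/-!
# [SemiAnbd] Cor. 3.9 (b): the vertex and edge maps of a quasi-geometric homomorphism AT ONE PAIR, with
# Thm. 3.7 (iv) at the SOURCE weakened to its two locally-finite-true halves (row «COR39b@LOCFIN-SOURCE-FREE»)

Mochizuki, *Semi-graphs of anabelioids*, Publ. RIMS **42** (2006), §3, Corollary 3.9, proof, manuscript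
p. 42 [cite: MochizukiSemiAnbd2006, Cor 3.9 p.42]: "any quasi-geometric morphism
`φ : B^temp(G) → B^temp(H)` induces a map from the vertices of `G` to the vertices of `H` … Similarly, by
considering nontrivial intersections of maximal compact subgroups, one obtains … a map from the edges of
`G` to the edges of `H`"; Theorem 3.7 (iv) p. 41.

PROOF-ONLY file (abc-iut cell, layer L3, seat abc-iut-L3-t10 gen 8, row «COR39b@LOCFIN-SOURCE-FREE»; 0
definitions, no named fact).  abc-iut-L3-d1's per-pair twins `existsUnique_vertexMap_of_isQuasiGeometric_at`
(`TemperedReconstructionVertexMapProofsAt.lean`, block B0b) and `exists_edge_mapsOnto_of_isQuasiGeometric_at`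
/ `existsUnique_edgeMap_of_isQuasiGeometric_at` (`TemperedReconstructionEdgeMapProofsAt.lean`, block B0c;
originals abc-iut-L3-t2) take Thm. 3.7 (iv) AT THE SOURCE `𝒢` as the whole per-graph iff
`MaximalCompactIffVerticialAt 𝒢` — which FAILS at infinite locally finite graphs such as abc-iut-L3-d1's
`𝒢_θ` (abc-iut-w6-d120, p443103).  Reading those proofs shows that at the source only the two halves

* (hvm) «verticial ⇒ maximal compact» — `(hmax𝒢 K).mpr`, and
* (hei) «a nontrivial edge-like subgroup of a closed edge is the intersection of two distinct maximal
  compact subgroups» — `(hint𝒢 L hL0).mpr`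

are ever used, and BOTH HOLD at every countable locally finite graph satisfying the hypotheses of Thm. 3.7
(abc-iut-w6-d062, `isMaximalCompactSubgroup_of_mem_verticialSubgroups_of_isLocallyFinite` /
`exists_maximalCompact_inf_eq_of_mem_edgeLikeSubgroups_of_isLocallyFinite`,
`TemperedMaximalCompactAnchoredOfLocallyFinite.lean`).  This file re-proves the three theorems VERBATIM with
the source-side input replaced by those two halves, stated as explicit hypotheses `hvm𝒢`, `hei𝒢` at the
source chart (decl suffix `_halvesAt`); the target side is unchanged (`MaximalCompactIffVerticialAt ℋ`,
`EdgeLikeDistinctAt ℋ`).  Consumers: `TemperedReconstructionR2bHomSourceHalvesAt.lean` (the locally open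
morphism) and `TemperedReconstructionCor39bLocallyFiniteSource.lean` (Cor. 3.9 (b) at every locally finite
SOURCE).  Originals untouched; outside the [IUTchIII] Cor. 3.12 cone (every print consumer of Cor. 3.9 has a
finite dual graph); a sharpening of OUR per-pair typing, not a claim about print; typed ≠ proved.
-/

open CategoryTheory Topology

namespace Literature.AnabelianGeometry.SemiGraphs

namespace ProfiniteSemiGraph

universe u

variable {𝒢 ℋ : ProfiniteSemiGraph.{u}}

/-! ### The vertex map, from «verticial ⇒ maximal compact» at the source -/

/-- **A quasi-geometric `φ` determines the map on vertices, from «verticial ⇒ maximal compact» AT the source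
chart and Thm. 3.7 (iv) AT `ℋ`** ([SemiAnbd] Cor. 3.9, proof, p. 42), with Thm. 3.7 (i), (ii): there is a
unique `f_V : V(G) → V(H)` such that every verticial subgroup of `π₁^temp(G)` at `v` maps onto an open
subgroup of some verticial subgroup of `π₁^temp(H)` at `f_V(v)` (twin of abc-iut-L3-d1's
`existsUnique_vertexMap_of_isQuasiGeometric_at`, source input weakened to the half `hvm𝒢`).
[cite: MochizukiSemiAnbd2006, Cor 3.9 p.42] -/
theorem existsUnique_vertexMap_of_isQuasiGeometric_halvesAt (h37i : VerticialInjective.{u})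
    (h37ii : VerticialDistinct.{u}) (h37ivℋ : MaximalCompactIffVerticialAt ℋ)
    (h𝒢 : 𝒢.Thm37Hypotheses) (hℋ : ℋ.Thm37Hypotheses) (c𝒢 : TemperedPiChart 𝒢)
    (cℋ : TemperedPiChart ℋ)
    (hvm𝒢 : ∀ (v : 𝒢.graph.Vertex) (K : Subgroup c𝒢.G), K ∈ verticialSubgroups c𝒢 v →
      IsMaximalCompactSubgroup K)
    (φ : c𝒢.G →ₜ* cℋ.G) (hφ : IsQuasiGeometric φ) :
    ∃! fV : 𝒢.graph.Vertex → ℋ.graph.Vertex,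
      ∀ (v : 𝒢.graph.Vertex) (K : Subgroup c𝒢.G), K ∈ verticialSubgroups c𝒢 v →
        ∃ K₂ ∈ verticialSubgroups cℋ (fV v), MapsOntoOpenSubgroupOf φ.toMonoidHom K K₂ := by
  obtain ⟨hmaxℋ, -⟩ := h37ivℋ hℋ cℋ
  -- the image of a verticial subgroup lies, as an open subgroup, in a verticial subgroup
  have himg : ∀ (v : 𝒢.graph.Vertex) (K : Subgroup c𝒢.G), K ∈ verticialSubgroups c𝒢 v →
      ∃ (w : ℋ.graph.Vertex) (K₂ : Subgroup cℋ.G), K₂ ∈ verticialSubgroups cℋ w ∧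
        MapsOntoOpenSubgroupOf φ.toMonoidHom K K₂ := by
    intro v K hK
    obtain ⟨K₂, hK₂, hmaps⟩ := hφ.maximal K (hvm𝒢 v K hK)
    obtain ⟨w, hK₂w⟩ := (hmaxℋ K₂).mp hK₂
    exact ⟨w, K₂, hK₂w, hmaps⟩
  -- choose, for each `v`, a verticial subgroup and the vertex of its image
  have hne : ∀ v : 𝒢.graph.Vertex, (verticialSubgroups c𝒢 v).Nonempty := fun v => (h37i 𝒢 h𝒢 c𝒢 v).1
  choose K₀ hK₀ using hne
  choose fV K₂ hK₂ hmaps using fun v => himg v (K₀ v) (hK₀ v)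
  -- any verticial subgroup at `v` goes to the same vertex
  have hall : ∀ (v : 𝒢.graph.Vertex) (K : Subgroup c𝒢.G), K ∈ verticialSubgroups c𝒢 v →
      ∃ K₂' ∈ verticialSubgroups cℋ (fV v), MapsOntoOpenSubgroupOf φ.toMonoidHom K K₂' := by
    intro v K hK
    obtain ⟨w, K₂', hK₂', hmaps'⟩ := himg v K hK
    -- `K = g K₀ g⁻¹`, so `φ(K) = φ(g) φ(K₀) φ(g)⁻¹ ≤ φ(g) K₂ φ(g)⁻¹`, verticial at `fV v`
    obtain ⟨g, rfl⟩ := exists_conj_of_mem_verticialSubgroups c𝒢 (hK₀ v) hK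
    have hle : ((K₀ v).map (MulAut.conj g).toMonoidHom).map φ.toMonoidHom ≤
        (K₂ v).map (MulAut.conj (φ g)).toMonoidHom := by
      rintro _ ⟨_, ⟨k, hk, rfl⟩, rfl⟩
      refine ⟨φ k, (hmaps v).1 ⟨k, hk, rfl⟩, ?_⟩
      change φ g * φ k * (φ g)⁻¹ = φ (g * k * g⁻¹)
      rw [map_mul, map_mul, map_inv]
    have hw : w = fV v :=
      vertex_eq_of_mapsOnto_of_le h37ii hℋ cℋ φ.toMonoidHom hK₂' (conj_mem_verticialSubgroups cℋ
        (hK₂ v) (φ g)) hmaps' hle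
    subst hw
    exact ⟨K₂', hK₂', hmaps'⟩
  refine ⟨fV, hall, fun fV' hfV' => funext fun v => ?_⟩
  obtain ⟨K₂', hK₂', hmaps'⟩ := hfV' v (K₀ v) (hK₀ v)
  exact vertex_eq_of_mapsOnto_of_le h37ii hℋ cℋ φ.toMonoidHom hK₂' (hK₂ v) hmaps' (hmaps v).1

/-! ### The edge map, from «edge-like = intersection of two distinct maximal compacts» at the source -/

/-- The image, under a quasi-geometric `φ`, of a nontrivial edge-like subgroup of a (closed) edge lies, as an
open subgroup, in an edge-like subgroup of a closed edge of `H` — from Def. 3.8, the half (hei) «a nontrivial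
edge-like subgroup of a closed edge is the intersection of two distinct maximal compact subgroups» AT the
source chart, and Thm. 3.7 (iv) AT `ℋ` (twin of abc-iut-L3-d1's `exists_edge_mapsOnto_of_isQuasiGeometric_at`).
[cite: MochizukiSemiAnbd2006, Cor 3.9 p.42] -/
theorem exists_edge_mapsOnto_of_isQuasiGeometric_halvesAt (h37ivℋ : MaximalCompactIffVerticialAt ℋ)
    (h𝒢 : Cor39Hypotheses 𝒢) (hℋ : Cor39Hypotheses ℋ) (c𝒢 : TemperedPiChart 𝒢) (cℋ : TemperedPiChart ℋ)
    (hei𝒢 : ∀ (e : 𝒢.graph.Edge) (L : Subgroup c𝒢.G), 𝒢.graph.IsClosedEdge e →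
      L ∈ edgeLikeSubgroups c𝒢 e → L ≠ ⊥ →
        ∃ K₁ K₂ : Subgroup c𝒢.G, IsMaximalCompactSubgroup K₁ ∧ IsMaximalCompactSubgroup K₂ ∧
          K₁ ≠ K₂ ∧ L = K₁ ⊓ K₂)
    {φ : c𝒢.G →ₜ* cℋ.G} (hφ : IsQuasiGeometric φ) {e : 𝒢.graph.Edge} {L : Subgroup c𝒢.G}
    (hL : L ∈ edgeLikeSubgroups c𝒢 e) (hL0 : L ≠ ⊥) :
    ∃ (e' : ℋ.graph.Edge) (L₂ : Subgroup cℋ.G), L₂ ∈ edgeLikeSubgroups cℋ e' ∧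
      MapsOntoOpenSubgroupOf φ.toMonoidHom L L₂ := by
  obtain ⟨-, hintℋ⟩ := h37ivℋ hℋ.thm37Hypotheses cℋ
  obtain ⟨K₁, H₁, hK₁, hH₁, hne, rfl⟩ := hei𝒢 e L (isClosedEdge_of_isGraph h𝒢.isGraph e) hL hL0
  obtain ⟨K₂, H₂, hK₂, hH₂, hne₂, hnt₂, hmaps⟩ := hφ.inter K₁ H₁ hK₁ hH₁ hne hL0
  obtain ⟨e', -, hL₂⟩ := (hintℋ (K₂ ⊓ H₂) hnt₂).mp ⟨K₂, H₂, hK₂, hH₂, hne₂, rfl⟩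
  exact ⟨e', K₂ ⊓ H₂, hL₂, hmaps⟩

/-- **A quasi-geometric `φ` determines the map on edges, from the half (hei) AT the source chart, Thm. 3.7
(iv) AT `ℋ` and `EdgeLikeDistinct` AT `ℋ`** ([SemiAnbd] Cor. 3.9, proof, p. 42), with Thm. 3.7 (i): there
is a unique `f_E : E(G) → E(H)` such that every edge-like subgroup of `π₁^temp(G)` at `e` maps onto an open
subgroup of some edge-like subgroup of `π₁^temp(H)` at `f_E(e)` (twin of abc-iut-L3-d1's
`existsUnique_edgeMap_of_isQuasiGeometric_at`). [cite: MochizukiSemiAnbd2006, Cor 3.9 p.42] -/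
theorem existsUnique_edgeMap_of_isQuasiGeometric_halvesAt (h37i : VerticialInjective.{u})
    (h37ivℋ : MaximalCompactIffVerticialAt ℋ) (hED : EdgeLikeDistinctAt ℋ)
    (h𝒢 : Cor39Hypotheses 𝒢) (hℋ : Cor39Hypotheses ℋ) (c𝒢 : TemperedPiChart 𝒢)
    (cℋ : TemperedPiChart ℋ)
    (hei𝒢 : ∀ (e : 𝒢.graph.Edge) (L : Subgroup c𝒢.G), 𝒢.graph.IsClosedEdge e →
      L ∈ edgeLikeSubgroups c𝒢 e → L ≠ ⊥ →
        ∃ K₁ K₂ : Subgroup c𝒢.G, IsMaximalCompactSubgroup K₁ ∧ IsMaximalCompactSubgroup K₂ ∧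
          K₁ ≠ K₂ ∧ L = K₁ ⊓ K₂)
    (φ : c𝒢.G →ₜ* cℋ.G) (hφ : IsQuasiGeometric φ) :
    ∃! fE : 𝒢.graph.Edge → ℋ.graph.Edge,
      ∀ (e : 𝒢.graph.Edge) (L : Subgroup c𝒢.G), L ∈ edgeLikeSubgroups c𝒢 e →
        ∃ L₂ ∈ edgeLikeSubgroups cℋ (fE e), MapsOntoOpenSubgroupOf φ.toMonoidHom L L₂ := by
  -- choose, for each edge, a nontrivial edge-like subgroup and the edge of its image
  choose L₀ hL₀ hL₀0 using fun e => exists_mem_edgeLikeSubgroups_ne_bot h37i h𝒢 c𝒢 e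
  choose fE L₂ hL₂ hmaps using fun e =>
    exists_edge_mapsOnto_of_isQuasiGeometric_halvesAt h37ivℋ h𝒢 hℋ c𝒢 cℋ hei𝒢 hφ (hL₀ e) (hL₀0 e)
  -- any edge-like subgroup at `e` goes to the same edge
  have hall : ∀ (e : 𝒢.graph.Edge) (L : Subgroup c𝒢.G), L ∈ edgeLikeSubgroups c𝒢 e →
      ∃ L₂' ∈ edgeLikeSubgroups cℋ (fE e), MapsOntoOpenSubgroupOf φ.toMonoidHom L L₂' := by
    intro e L hL
    obtain ⟨g, rfl⟩ := exists_conj_of_mem_edgeLikeSubgroups c𝒢 (hL₀ e) hL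
    have hL0 : (L₀ e).map (MulAut.conj g).toMonoidHom ≠ ⊥ := fun h0 =>
      hL₀0 e ((Subgroup.map_eq_bot_iff_of_injective _ (MulAut.conj g).injective).mp h0)
    obtain ⟨e', L₂', hL₂', hmaps'⟩ :=
      exists_edge_mapsOnto_of_isQuasiGeometric_halvesAt h37ivℋ h𝒢 hℋ c𝒢 cℋ hei𝒢 hφ hL hL0
    have hle : ((L₀ e).map (MulAut.conj g).toMonoidHom).map φ.toMonoidHom ≤
        (L₂ e).map (MulAut.conj (φ g)).toMonoidHom := by
      rintro _ ⟨_, ⟨k, hk, rfl⟩, rfl⟩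
      refine ⟨φ k, (hmaps e).1 ⟨k, hk, rfl⟩, ?_⟩
      change φ g * φ k * (φ g)⁻¹ = φ (g * k * g⁻¹)
      rw [map_mul, map_mul, map_inv]
    have he : e' = fE e :=
      edge_eq_of_mapsOnto_of_le_at hED hℋ.thm37Hypotheses cℋ φ.toMonoidHom hL₂'
        (conj_mem_edgeLikeSubgroups' cℋ (hL₂ e) (φ g)) hmaps' hle
    subst he
    exact ⟨L₂', hL₂', hmaps'⟩
  refine ⟨fE, hall, fun fE' hfE' => funext fun e => ?_⟩
  obtain ⟨L₂', hL₂', hmaps'⟩ := hfE' e (L₀ e) (hL₀ e)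
  exact edge_eq_of_mapsOnto_of_le_at hED hℋ.thm37Hypotheses cℋ φ.toMonoidHom hL₂' (hL₂ e) hmaps'
    (hmaps e).1

/-! ### The two halves HOLD at every locally finite source (abc-iut-w6-d062), and follow from the full (iv) -/

/-- At a countable LOCALLY FINITE graph satisfying the hypotheses of Thm. 3.7, the half (hvm) «verticial ⇒
maximal compact» holds at every chart (abc-iut-w6-d062's
`isMaximalCompactSubgroup_of_mem_verticialSubgroups_of_isLocallyFinite`, re-exported in the binder shape of
this file). [cite: MochizukiSemiAnbd2006, Thm 3.7(iv) p.41] -/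
theorem hvm_of_isLocallyFinite (h37 : 𝒢.Thm37Hypotheses) (hlf : 𝒢.graph.IsLocallyFinite)
    (c : TemperedPiChart 𝒢) :
    ∀ (v : 𝒢.graph.Vertex) (K : Subgroup c.G), K ∈ verticialSubgroups c v → IsMaximalCompactSubgroup K :=
  fun _ _ hK => 𝒢.isMaximalCompactSubgroup_of_mem_verticialSubgroups_of_isLocallyFinite h37 hlf c hK

/-- At a countable LOCALLY FINITE graph satisfying the hypotheses of Thm. 3.7, the half (hei) «a nontrivial
edge-like subgroup of a closed edge is the intersection of two distinct maximal compact subgroups» holds at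
every chart (abc-iut-w6-d062's `exists_maximalCompact_inf_eq_of_mem_edgeLikeSubgroups_of_isLocallyFinite`).
[cite: MochizukiSemiAnbd2006, Thm 3.7(iv) p.41] -/
theorem hei_of_isLocallyFinite (h37 : 𝒢.Thm37Hypotheses) (hlf : 𝒢.graph.IsLocallyFinite)
    (c : TemperedPiChart 𝒢) :
    ∀ (e : 𝒢.graph.Edge) (L : Subgroup c.G), 𝒢.graph.IsClosedEdge e → L ∈ edgeLikeSubgroups c e →
      L ≠ ⊥ → ∃ K₁ K₂ : Subgroup c.G, IsMaximalCompactSubgroup K₁ ∧ IsMaximalCompactSubgroup K₂ ∧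
        K₁ ≠ K₂ ∧ L = K₁ ⊓ K₂ :=
  fun _ _ he hL hLne =>
    𝒢.exists_maximalCompact_inf_eq_of_mem_edgeLikeSubgroups_of_isLocallyFinite h37 hlf c he hL hLne

/-- Both halves follow from the full per-graph Thm. 3.7 (iv) `MaximalCompactIffVerticialAt 𝒢` (so the
`_halvesAt` theorems specialise to abc-iut-L3-d1's `_at` theorems): the half (hvm).
[cite: MochizukiSemiAnbd2006, Thm 3.7(iv) p.41] -/
theorem hvm_of_maximalCompactIffVerticialAt (h37iv : MaximalCompactIffVerticialAt 𝒢)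
    (h37 : 𝒢.Thm37Hypotheses) (c : TemperedPiChart 𝒢) :
    ∀ (v : 𝒢.graph.Vertex) (K : Subgroup c.G), K ∈ verticialSubgroups c v → IsMaximalCompactSubgroup K :=
  fun v K hK => ((h37iv h37 c).1 K).mpr ⟨v, hK⟩

/-- Both halves follow from the full per-graph Thm. 3.7 (iv): the half (hei).
[cite: MochizukiSemiAnbd2006, Thm 3.7(iv) p.41] -/
theorem hei_of_maximalCompactIffVerticialAt (h37iv : MaximalCompactIffVerticialAt 𝒢)
    (h37 : 𝒢.Thm37Hypotheses) (c : TemperedPiChart 𝒢) :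
    ∀ (e : 𝒢.graph.Edge) (L : Subgroup c.G), 𝒢.graph.IsClosedEdge e → L ∈ edgeLikeSubgroups c e →
      L ≠ ⊥ → ∃ K₁ K₂ : Subgroup c.G, IsMaximalCompactSubgroup K₁ ∧ IsMaximalCompactSubgroup K₂ ∧
        K₁ ≠ K₂ ∧ L = K₁ ⊓ K₂ :=
  fun e L he hL hLne => ((h37iv h37 c).2 L hLne).mpr ⟨e, he, hL⟩

end ProfiniteSemiGraph

end Literature.AnabelianGeometry.SemiGraphs
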